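import Literature.AlgebraicGeometry.Motives.MixedHodgeStructureHodgeTateSplitting
import Literature.AlgebraicGeometry.Motives.MixedHodgeStructureTateHomHodgeClasses
import Literature.AlgebraicGeometry.Motives.MixedHodgeExtensionCongruence
import HarnessLib

/-!
# Hodge–Tate structures are iterated extensions of Tate structures

Goncharov, *Multiple polylogarithms and mixed Tate motives* (2001), §3.1 recalls (after Beilinson–Deligne):
"the pair `(𝓜, K(1))` is called a mixed Tate category if the objects `K(n)` are mutually nonisomorphic,
any simple object is isomorphic to one of them and `Ext¹_𝓜(K(0), K(n)) = 0` if `n ≤ 0`", and "any object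
`M` of a mixed Tate category has a canonical weight filtration `W_•M` indexed by `2ℤ` such that `gr^W_{2n}M`
is a direct sum of copies of `K(-n)`"; §4.1: "Applying the above construction to the category `MHS/ℚ` of
mixed Hodge structures over `ℚ` we get the mixed Tate category `𝓗_T` of `ℚ`-rational Hodge–Tate
structures … a Hodge–Tate structure is a `ℚ`-rational mixed Hodge structure with weight `-2k` quotients
isomorphic to a direct sum of copies of `ℚ(k)`."

The tree has the Tate objects `ℚ(-p) = (HodgeStructure.tate (-p)).toMixedHodgeStructure` with
`Hom(ℚ(-p), ℚ(-q)) = 0` for `p ≠ q` and `End ℚ(-p) = ℚ` (`MixedHodgeExtensionTateByTate.lean`: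
`Hom.tate_eq_zero_of_ne`, `Hom.tate_toLinearMap_eq_smul`), `Ext¹(ℚ(-p), ℚ(-q)) = 0` for `p ≤ q` and
`≅ ℂ/ℚ` for `q < p` (`Ext.subsingleton_tate_of_le`, `Ext.tateTateEquiv`), `Ext² = 0`
(`MixedHodgeExtensionYonedaExtTwo.lean`), the morphisms `ℚ(-p) → H` as Hodge classes
(`MixedHodgeStructureTateHomHodgeClasses.lean`), and the Hodge–Tate structures with their stability under
subquotients and extensions (`MixedHodgeStructureHodgeTate.lean`, `…HodgeTateSplitting.lean`). This file
supplies the remaining axiom "any simple object is isomorphic to a `ℚ(n)`" and the dévissage of a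
Hodge–Tate structure into Tate structures:

* §1 `exists_lowestWeight` — a mixed Hodge structure on a non-zero (finite-dimensional) space has a
  lowest weight `n` (`W_{n-1} = 0 ≠ W_n`); for a Hodge–Tate structure it is even
  (`IsHodgeTate.exists_lowestWeight_even`).
* §2 **`IsHodgeTate.W_eq_hodgeClasses_of_W_pred_eq_bot`** — at the lowest weight `2k` of a Hodge–Tate
  structure EVERY vector of `W_{2k}` is a Hodge class of type `(k, k)` (`W_{2k,ℂ} = I^{k,k} ⊆ F^k`).
* §3 **`IsHodgeTate.exists_hom_tate_injective`** — every non-zero Hodge–Tate structure contains a Tate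
  structure `ℚ(-k)` (an injective morphism `ℚ(-k) → H`); **`IsHodgeTate.exists_hom_tate_bijective_of_simple`**
  — a simple Hodge–Tate structure (no sub-MHS other than `0` and `H`) is isomorphic to a Tate structure,
  and is one-dimensional (`finrank_eq_one_of_simple`).
* §4 **dévissage**: `IsHodgeTate.exists_tate_sub_coker` — a non-zero Hodge–Tate structure `H` is an
  extension `0 → ℚ(-k) → H → H' → 0` of a Hodge–Tate structure `H'` of dimension `dim H - 1` by a Tate
  structure; iterating, `H` is a successive extension of `dim H` Tate structures.

All statements proved; no named facts.

## References

* [Goncharov2001MultiplePolylogarithms] A. B. Goncharov, Multiple polylogarithms and mixed Tate motives,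
  arXiv:math/0103059 (2001), §3.1 (mixed Tate categories, after Beilinson–Deligne), §4.1 (Hodge–Tate
  structures) (held text `paper:arxiv-math_0103059`, pp. 19, 22).
* [Marcolli2009] M. Marcolli, Feynman motives (2010), §2.7 (2.49).
* [DeligneHodgeII1971] P. Deligne, Théorie de Hodge II, 2.1.13, 2.3.1, 2.3.5.
* [CattaniElZeinGriffithsLe2014] E. Cattani et al. (eds.), Hodge Theory (2014), Prop. 3.2.19, Thm. 3.2.18.
-/

open scoped TensorProduct

noncomputable section

namespace Literature.AlgebraicGeometry.Motives

namespace MixedHodgeStructure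

universe u v

variable {V : Type u} [AddCommGroup V] [Module ℚ V]
variable {V' : Type v} [AddCommGroup V'] [Module ℚ V']

open Module
open HodgeStructure (tate ofRat)

/-! ### §1 The lowest weight -/

/-- **A mixed Hodge structure on a non-zero space has a lowest weight**: there is `n` with `W_{n-1} = 0`
and `W_n ≠ 0` (the weight filtration is finite and exhaustive). [cite: DeligneHodgeII1971, 2.3.1] -/
theorem exists_lowestWeight [Nontrivial V] (H : MixedHodgeStructure V) :
    ∃ n : ℤ, H.W (n - 1) = ⊥ ∧ H.W n ≠ ⊥ := by
  classical
  obtain ⟨t, ht⟩ := H.exists_W_eq_top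
  obtain ⟨b, hb⟩ := H.exists_W_eq_bot
  have hbdd : ∃ b : ℤ, ∀ z : ℤ, H.W z ≠ ⊥ → b ≤ z := by
    refine ⟨b, fun z hz => ?_⟩
    by_contra hzb
    exact hz (eq_bot_iff.2 (hb ▸ H.monotone_W (by omega)))
  have hinh : ∃ z : ℤ, H.W z ≠ ⊥ := ⟨t, by rw [ht]; exact top_ne_bot⟩
  obtain ⟨n, hn, hmin⟩ := Int.exists_least_of_bdd hbdd hinh
  refine ⟨n, ?_, hn⟩
  by_contra h
  have := hmin (n - 1) h
  omega

/-- **The lowest weight of a non-zero Hodge–Tate structure is even**: there is `k` with `W_{2k-1} = 0`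
and `W_{2k} ≠ 0` (`W_{2k+1} = W_{2k}` for a Hodge–Tate structure). [cite: Goncharov2001MultiplePolylogarithms, §4.1]
[cite: Marcolli2009, (2.49)] -/
theorem IsHodgeTate.exists_lowestWeight_even [FiniteDimensional ℚ V] [Nontrivial V] {H : MixedHodgeStructure V}
    (h : H.IsHodgeTate) : ∃ k : ℤ, H.W (2 * k - 1) = ⊥ ∧ H.W (2 * k) ≠ ⊥ := by
  obtain ⟨n, hn1, hn⟩ := H.exists_lowestWeight
  obtain ⟨k, hk | hk⟩ := Int.even_or_odd' n
  · exact ⟨k, by rw [← hk]; exact hn1, by rw [← hk]; exact hn⟩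
  · exfalso
    apply hn
    rw [hk, h.W_odd_eq k, show 2 * k = n - 1 by omega, hn1]

/-! ### §2 At the lowest weight every vector is a Hodge class -/

section Lowest

variable [FiniteDimensional ℚ V] {H : MixedHodgeStructure V}

/-- If `W_{2k-1} = 0` then `W_{2k,ℂ} = I^{k,k}` for a Hodge–Tate structure.
[cite: CattaniElZeinGriffithsLe2014, Prop. 3.2.19] [cite: Goncharov2001MultiplePolylogarithms, §4.1] -/
theorem IsHodgeTate.baseChange_W_eq_deligneI_of_W_pred_eq_bot (h : H.IsHodgeTate) {k : ℤ}
    (hk : H.W (2 * k - 1) = ⊥) : (H.W (2 * k)).baseChange ℂ = H.deligneI k k := by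
  rw [← h.deligneI_sup_baseChange_W_pred k, hk, Submodule.baseChange_bot, sup_bot_eq]

/-- If `W_{2k-1} = 0` then `W_{2k,ℂ} ⊆ F^k` for a Hodge–Tate structure.
[cite: CattaniElZeinGriffithsLe2014, Prop. 3.2.19] [cite: Goncharov2001MultiplePolylogarithms, §4.1] -/
theorem IsHodgeTate.baseChange_W_le_F_of_W_pred_eq_bot (h : H.IsHodgeTate) {k : ℤ}
    (hk : H.W (2 * k - 1) = ⊥) : (H.W (2 * k)).baseChange ℂ ≤ H.F k := by
  rw [h.baseChange_W_eq_deligneI_of_W_pred_eq_bot hk]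
  exact H.deligneI_le_F k k

/-- **At the lowest weight `2k` of a Hodge–Tate structure every vector of `W_{2k}` is a Hodge class of
type `(k, k)`**: `W_{2k} = Hdg^k(H)` when `W_{2k-1} = 0` (the sub-MHS `W_{2k}H` is pure of type `(k, k)`:
"weight `-2k` quotients isomorphic to a direct sum of copies of `ℚ(k)`", here for the lowest weight as a
SUB-object). [cite: Goncharov2001MultiplePolylogarithms, §4.1] -/
theorem IsHodgeTate.W_eq_hodgeClasses_of_W_pred_eq_bot (h : H.IsHodgeTate) {k : ℤ}
    (hk : H.W (2 * k - 1) = ⊥) : H.W (2 * k) = H.hodgeClasses k := by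
  refine le_antisymm (fun v hv => ?_) (H.hodgeClasses_le_W k)
  rw [mem_hodgeClasses_iff]
  exact ⟨hv, h.baseChange_W_le_F_of_W_pred_eq_bot hk (Submodule.tmul_mem_baseChange_of_mem 1 hv)⟩

end Lowest

/-! ### §3 Tate sub-objects; simple Hodge–Tate structures are Tate structures -/

section TateSub

variable [FiniteDimensional ℚ V] {H : MixedHodgeStructure V}

omit [FiniteDimensional ℚ V] in
/-- The morphism `ℚ(-k) → H`, `q ↦ q • v`, of a Hodge class `v` is injective iff `v ≠ 0`.
[cite: DeligneHodgeII1971, 2.1.13 and 2.3.1] -/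
theorem Hom.ofHodgeClass_injective_iff (H : MixedHodgeStructure V) (k : ℤ) (v : H.hodgeClasses k) :
    Function.Injective (Hom.ofHodgeClass H k v).toLinearMap ↔ (v : V) ≠ 0 := by
  constructor
  · intro hinj hv
    have h1 : (Hom.ofHodgeClass H k v).toLinearMap 1 = (Hom.ofHodgeClass H k v).toLinearMap 0 := by
      rw [Hom.ofHodgeClass_toLinearMap_apply, Hom.ofHodgeClass_toLinearMap_apply, hv, smul_zero, smul_zero]
    exact one_ne_zero (hinj h1)
  · intro hv q q' hqq'
    rw [Hom.ofHodgeClass_toLinearMap_apply, Hom.ofHodgeClass_toLinearMap_apply] at hqq'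
    exact smul_left_injective ℚ hv hqq'

/-- **Every non-zero Hodge–Tate structure contains a Tate structure**: there are `k` (half the lowest
weight) and an INJECTIVE morphism `ℚ(-k) → H` of mixed Hodge structures. [cite: Goncharov2001MultiplePolylogarithms, §4.1] -/
theorem IsHodgeTate.exists_hom_tate_injective [Nontrivial V] (h : H.IsHodgeTate) :
    ∃ (k : ℤ) (f : Hom (tate (-k)).toMixedHodgeStructure H), Function.Injective f.toLinearMap := by
  obtain ⟨k, hk1, hk⟩ := h.exists_lowestWeight_even
  obtain ⟨v, hv, hv0⟩ := (Submodule.ne_bot_iff _).1 hk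
  rw [h.W_eq_hodgeClasses_of_W_pred_eq_bot hk1] at hv
  exact ⟨k, Hom.ofHodgeClass H k ⟨v, hv⟩, (Hom.ofHodgeClass_injective_iff H k ⟨v, hv⟩).2 hv0⟩

/-- With the lowest weight made explicit: for `W_{2k-1} = 0 ≠ W_{2k}` there is an injective `ℚ(-k) → H`
with image inside `W_{2k}`. [cite: Goncharov2001MultiplePolylogarithms, §4.1] -/
theorem IsHodgeTate.exists_hom_tate_injective_of_W (h : H.IsHodgeTate) {k : ℤ} (hk1 : H.W (2 * k - 1) = ⊥)
    (hk : H.W (2 * k) ≠ ⊥) :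
    ∃ f : Hom (tate (-k)).toMixedHodgeStructure H,
      Function.Injective f.toLinearMap ∧ LinearMap.range f.toLinearMap ≤ H.W (2 * k) := by
  obtain ⟨v, hv, hv0⟩ := (Submodule.ne_bot_iff _).1 hk
  have hv' : v ∈ H.hodgeClasses k := by rwa [← h.W_eq_hodgeClasses_of_W_pred_eq_bot hk1]
  refine ⟨Hom.ofHodgeClass H k ⟨v, hv'⟩, (Hom.ofHodgeClass_injective_iff H k ⟨v, hv'⟩).2 hv0, ?_⟩
  rintro _ ⟨q, rfl⟩
  rw [Hom.ofHodgeClass_toLinearMap_apply]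
  exact Submodule.smul_mem _ q hv

/-- **A simple Hodge–Tate structure is isomorphic to a Tate structure** ("any simple object is isomorphic
to one of the `K(n)`"): if the only sub-mixed Hodge structures of the non-zero Hodge–Tate structure `H` are
`0` and `H`, then some `ℚ(-k) → H` is a BIJECTIVE morphism (an isomorphism of MHS, `Hom.inverse`).
[cite: Goncharov2001MultiplePolylogarithms, §3.1 and §4.1] -/
theorem IsHodgeTate.exists_hom_tate_bijective_of_simple [Nontrivial V] (h : H.IsHodgeTate)
    (hs : ∀ S : SubMixedHodgeStructure H, S.toSubmodule = ⊥ ∨ S.toSubmodule = ⊤) :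
    ∃ (k : ℤ) (f : Hom (tate (-k)).toMixedHodgeStructure H), Function.Bijective f.toLinearMap := by
  obtain ⟨k, f, hf⟩ := h.exists_hom_tate_injective
  refine ⟨k, f, hf, ?_⟩
  rcases hs f.range with h0 | h1
  · exfalso
    rw [Hom.range_toSubmodule, LinearMap.range_eq_bot] at h0
    have h10 : f.toLinearMap 1 = 0 := by rw [h0, LinearMap.zero_apply]
    exact one_ne_zero (hf (h10.trans (map_zero f.toLinearMap).symm))
  · rw [Hom.range_toSubmodule] at h1
    exact LinearMap.range_eq_top.1 h1

/-- **A simple Hodge–Tate structure is one-dimensional.** [cite: Goncharov2001MultiplePolylogarithms, §3.1 and §4.1] -/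
theorem IsHodgeTate.finrank_eq_one_of_simple [Nontrivial V] (h : H.IsHodgeTate)
    (hs : ∀ S : SubMixedHodgeStructure H, S.toSubmodule = ⊥ ∨ S.toSubmodule = ⊤) : finrank ℚ V = 1 := by
  obtain ⟨k, f, hf⟩ := h.exists_hom_tate_bijective_of_simple hs
  rw [← (LinearEquiv.ofBijective f.toLinearMap hf).finrank_eq, Module.finrank_self]

/-- Conversely, **the Tate structures are simple**: a sub-MHS of `ℚ(-k)` is `0` or everything (the carrier
is the one-dimensional space `ℚ`). [cite: Goncharov2001MultiplePolylogarithms, §3.1] -/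
theorem tate_simple (k : ℤ) (S : SubMixedHodgeStructure (tate (-k)).toMixedHodgeStructure) :
    S.toSubmodule = ⊥ ∨ S.toSubmodule = ⊤ := by
  rcases eq_or_ne S.toSubmodule ⊥ with h | h
  · exact Or.inl h
  · refine Or.inr ?_
    obtain ⟨q, hq, hq0⟩ := (Submodule.ne_bot_iff _).1 h
    rw [eq_top_iff]
    intro x _
    have hx : x = (x * q⁻¹) • q := by rw [smul_eq_mul, inv_mul_cancel_right₀ hq0]
    rw [hx]
    exact S.toSubmodule.smul_mem _ hq

end TateSub

/-! ### §4 Dévissage: `0 → ℚ(-k) → H → H' → 0` with `H'` Hodge–Tate of dimension one less -/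

section Devissage

variable [FiniteDimensional ℚ V] {H : MixedHodgeStructure V}

/-- **Dévissage of a Hodge–Tate structure**: a non-zero Hodge–Tate structure `H` is an extension of a
Hodge–Tate structure `H' = Coker(ℚ(-k) → H)` of dimension `dim H - 1` by a Tate structure `ℚ(-k)`, `2k`
the lowest weight; `0 → ℚ(-k) → H → H' → 0` is exact. Iterating, every Hodge–Tate structure is a successive
extension of Tate structures (the mixed Tate category `𝓗_T` is generated by the `ℚ(n)` under extensions).
[cite: Goncharov2001MultiplePolylogarithms, §3.1 and §4.1] -/
theorem IsHodgeTate.exists_tate_sub_coker [Nontrivial V] (h : H.IsHodgeTate) :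
    ∃ (k : ℤ) (f : Hom (tate (-k)).toMixedHodgeStructure H),
      Function.Injective f.toLinearMap ∧ Function.Exact f.toLinearMap f.cokerMkQ.toLinearMap ∧
        Function.Surjective f.cokerMkQ.toLinearMap ∧ f.coker.IsHodgeTate ∧
          finrank ℚ (V ⧸ LinearMap.range f.toLinearMap) + 1 = finrank ℚ V := by
  obtain ⟨k, f, hf⟩ := h.exists_hom_tate_injective
  refine ⟨k, f, hf, f.exact_cokerMkQ, f.cokerMkQ_surjective, h.coker f, ?_⟩
  have h1 : finrank ℚ (LinearMap.range f.toLinearMap) = 1 := by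
    rw [LinearMap.finrank_range_of_inj hf, Module.finrank_self]
  rw [← h1, Submodule.finrank_quotient_add_finrank]

omit [FiniteDimensional ℚ V] in
/-- The extension `0 → ℚ(-k) → H → Coker → 0` attached to an injective morphism from a Tate structure, as a
tree `Extension` (of `Coker` by `ℚ(-k)`). [cite: Goncharov2001MultiplePolylogarithms, §4.1] -/
def tateSubExtension {k : ℤ} (f : Hom (tate (-k)).toMixedHodgeStructure H) (hf : Function.Injective f.toLinearMap) :
    Extension f.coker (tate (-k)).toMixedHodgeStructure V :=
  Extension.ofExact H f f.cokerMkQ hf f.cokerMkQ_surjective f.exact_cokerMkQ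

omit [FiniteDimensional ℚ V] in
/-- The middle term of `tateSubExtension f hf` is `H` (by `rfl`). [cite: Goncharov2001MultiplePolylogarithms, §4.1] -/
@[simp] theorem tateSubExtension_mhs {k : ℤ} (f : Hom (tate (-k)).toMixedHodgeStructure H)
    (hf : Function.Injective f.toLinearMap) : (tateSubExtension f hf).mhs = H := rfl

/-- **Every non-zero Hodge–Tate structure is an extension of a Hodge–Tate structure of smaller dimension by
a Tate structure** (extension form of the dévissage). [cite: Goncharov2001MultiplePolylogarithms, §3.1 and §4.1] -/
theorem IsHodgeTate.exists_extension_tate [Nontrivial V] (h : H.IsHodgeTate) :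
    ∃ (k : ℤ) (f : Hom (tate (-k)).toMixedHodgeStructure H) (hf : Function.Injective f.toLinearMap),
      (tateSubExtension f hf).mhs = H ∧ f.coker.IsHodgeTate ∧
        finrank ℚ (V ⧸ LinearMap.range f.toLinearMap) < finrank ℚ V := by
  obtain ⟨k, f, hf, -, -, hcoker, hdim⟩ := h.exists_tate_sub_coker
  exact ⟨k, f, hf, rfl, hcoker, by omega⟩

end Devissage

end MixedHodgeStructure

end Literature.AlgebraicGeometry.Motives

end
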